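import Literature.Analysis.FluidPDE.HeatKernelMultiplierDerivatives
import HarnessLib

/-!
# Sums of homogeneous symbols in the multiplier heat potentials of Lemma 13.6

Analysis/FluidPDE support file (everything proved, no definitions) in the decomposition of the
named fact `Literature.Analysis.FluidPDE.LemarieRieusset2016.lemma13_6_duhamel`
(`CKNMorreyHolder.lean`: Lemarié-Rieusset 2016, §13.9 Step 3 and Lemma 13.6, pp. 474–478). In the
localised Duhamel formula the slot `∑ⱼₗ σ₃(D)(W₊ ⊛ Bⱼₗ)` of `LocalisedDuhamelData.potential`
receives, on the same datum `Bⱼₖ = φuⱼu_k`, both the Calderón–Zygmund symbol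
`ξ_kξⱼξₗ/|ξ|²` (from `∂_k∂ⱼ∂ₗΔ⁻¹(φuⱼuₗ)`, (13.51)) and the transport symbol `ξⱼ` (from
`∂ⱼ(φuⱼu_k)`); the symbol of the slot is their sum. This file proves the additivity of the
multiplier kernels and potentials in the symbol (`multiplierHeatKernel_add`,
`multiplierHeatKernelFwd_add`, `multiplierHeatPotential_add` — the last wherever both potentials
converge absolutely), the integrability of `derivSymbol · e^{-4π²θ|ξ|²}` and
`oseenSymbol · e^{-4π²θ|ξ|²}` that it requires, and the smoothness off the origin and degree-one
homogeneity of the summed symbol (`contDiffOn_duhamelSymbol₃`, `duhamelSymbol₃_smul`).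

## References

* P. G. Lemarié-Rieusset, *The Navier–Stokes Problem in the 21st Century*, CRC Press (2016),
  §13.9 Step 3, (13.51)–(13.52), pp. 474–475; Lemma 13.6 p. 478. [LemarieRieusset2016]
-/

noncomputable section

open MeasureTheory Set Function Filter Real Complex
open scoped Topology RealInnerProductSpace FourierTransform

namespace Literature.Analysis.FluidPDE

open UnboundedOperators

/-! ### Additivity of `𝓕⁻` and of the multiplier kernels -/

/-- `𝓕⁻ (g₁ + g₂) = 𝓕⁻ g₁ + 𝓕⁻ g₂` pointwise, for integrable `g₁, g₂`. [folklore] -/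
theorem fourierInv_add_apply {g₁ g₂ : EuclideanSpace ℝ (Fin 3) → ℂ} (h₁ : Integrable g₁ volume)
    (h₂ : Integrable g₂ volume) (x : EuclideanSpace ℝ (Fin 3)) :
    𝓕⁻ (fun ξ => g₁ ξ + g₂ ξ) x = 𝓕⁻ g₁ x + 𝓕⁻ g₂ x := by
  have hint : ∀ {g : EuclideanSpace ℝ (Fin 3) → ℂ}, Integrable g volume →
      Integrable (fun v : EuclideanSpace ℝ (Fin 3) => (𝐞 (inner ℝ v x) : Circle) • g v) volume := by
    intro g hg
    have := (Real.fourierIntegral_convergent_iff (-x)).2 hg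
    simpa [inner_neg_right] using this
  simp only [Real.fourierInv_eq, smul_add]
  exact integral_add (hint h₁) (hint h₂)

/-- **Additivity of the multiplier heat kernel in the symbol**, for symbols whose products with
the Gaussian are integrable. [folklore] -/
theorem multiplierHeatKernel_add {σ₁ σ₂ : EuclideanSpace ℝ (Fin 3) → ℂ} {θ : ℝ}
    (h₁ : Integrable (fun ξ => σ₁ ξ * (heatSymbol θ ξ : ℂ)) volume)
    (h₂ : Integrable (fun ξ => σ₂ ξ * (heatSymbol θ ξ : ℂ)) volume) (y : EuclideanSpace ℝ (Fin 3)) :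
    multiplierHeatKernel (fun ξ => σ₁ ξ + σ₂ ξ) θ y =
      multiplierHeatKernel σ₁ θ y + multiplierHeatKernel σ₂ θ y := by
  unfold multiplierHeatKernel
  have h : (fun ξ : EuclideanSpace ℝ (Fin 3) => (σ₁ ξ + σ₂ ξ) * (heatSymbol θ ξ : ℂ)) =
      fun ξ => σ₁ ξ * (heatSymbol θ ξ : ℂ) + σ₂ ξ * (heatSymbol θ ξ : ℂ) := by
    funext ξ; ring
  rw [h, fourierInv_add_apply h₁ h₂]

/-- Additivity of the forward multiplier heat kernel in the symbol. [folklore] -/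
theorem multiplierHeatKernelFwd_add {σ₁ σ₂ : EuclideanSpace ℝ (Fin 3) → ℂ} {ν : ℝ} (hν : 0 < ν)
    (h₁ : ∀ θ : ℝ, 0 < θ → Integrable (fun ξ => σ₁ ξ * (heatSymbol θ ξ : ℂ)) volume)
    (h₂ : ∀ θ : ℝ, 0 < θ → Integrable (fun ξ => σ₂ ξ * (heatSymbol θ ξ : ℂ)) volume)
    (p : ℝ × EuclideanSpace ℝ (Fin 3)) :
    multiplierHeatKernelFwd ν (fun ξ => σ₁ ξ + σ₂ ξ) p =
      multiplierHeatKernelFwd ν σ₁ p + multiplierHeatKernelFwd ν σ₂ p := by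
  unfold multiplierHeatKernelFwd
  split_ifs with hp
  · exact multiplierHeatKernel_add (h₁ _ (mul_pos hν hp)) (h₂ _ (mul_pos hν hp)) p.2
  · simp

/-- **Additivity of the multiplier heat potential in the symbol**, at every point where both
potentials converge absolutely. [folklore] -/
theorem multiplierHeatPotential_add {σ₁ σ₂ : EuclideanSpace ℝ (Fin 3) → ℂ} {ν : ℝ} (hν : 0 < ν)
    (h₁ : ∀ θ : ℝ, 0 < θ → Integrable (fun ξ => σ₁ ξ * (heatSymbol θ ξ : ℂ)) volume)
    (h₂ : ∀ θ : ℝ, 0 < θ → Integrable (fun ξ => σ₂ ξ * (heatSymbol θ ξ : ℂ)) volume)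
    (g : ℝ × EuclideanSpace ℝ (Fin 3) → ℝ) (w : ℝ × EuclideanSpace ℝ (Fin 3))
    (hw₁ : Integrable (fun z => multiplierHeatKernelFwd ν σ₁ (w - z) * (g z : ℂ)) volume)
    (hw₂ : Integrable (fun z => multiplierHeatKernelFwd ν σ₂ (w - z) * (g z : ℂ)) volume) :
    multiplierHeatPotential ν (fun ξ => σ₁ ξ + σ₂ ξ) g w =
      multiplierHeatPotential ν σ₁ g w + multiplierHeatPotential ν σ₂ g w := by
  unfold multiplierHeatPotential
  rw [← integral_add hw₁ hw₂]
  refine integral_congr_ae (Eventually.of_forall fun z => ?_)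
  dsimp only
  rw [multiplierHeatKernelFwd_add hν h₁ h₂, add_mul]

/-! ### Integrability of the two symbols against the Gaussian -/

/-- `|2πi⟪ξ, v⟫| e^{-4π²θ|ξ|²}` is integrable (`θ > 0`). [folklore] -/
theorem integrable_derivSymbol_mul_heatSymbol {θ : ℝ} (hθ : 0 < θ) (v : EuclideanSpace ℝ (Fin 3)) :
    Integrable (fun ξ => derivSymbol v ξ * (heatSymbol θ ξ : ℂ)) volume := by
  have hmeas : AEStronglyMeasurable (fun ξ => derivSymbol v ξ * (heatSymbol θ ξ : ℂ)) volume := by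
    refine (Continuous.mul ?_ (continuous_heatSymbol_ofReal θ)).aestronglyMeasurable
    unfold derivSymbol
    fun_prop
  refine ((integrable_pow_mul_norm_heatSymbol hθ 1).const_mul (2 * π * ‖v‖)).mono' hmeas ?_
  refine Eventually.of_forall fun ξ => ?_
  rw [norm_mul]
  have hd : ‖derivSymbol v ξ‖ ≤ 2 * π * ‖v‖ * ‖ξ‖ ^ 1 := by
    unfold derivSymbol
    rw [norm_mul, norm_mul, norm_mul, Complex.norm_real, Complex.norm_I, mul_one, pow_one,
      Complex.norm_ofNat, Complex.norm_real, Real.norm_of_nonneg pi_pos.le, Real.norm_eq_abs]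
    have := abs_real_inner_le_norm ξ v
    nlinarith [pi_pos, norm_nonneg v, norm_nonneg ξ]
  calc ‖derivSymbol v ξ‖ * ‖(heatSymbol θ ξ : ℂ)‖ ≤ 2 * π * ‖v‖ * ‖ξ‖ ^ 1 * ‖(heatSymbol θ ξ : ℂ)‖ := by
        gcongr
    _ = 2 * π * ‖v‖ * (‖ξ‖ ^ 1 * ‖(heatSymbol θ ξ : ℂ)‖) := by ring

/-- The Oseen symbol is measurable. [folklore] -/
theorem measurable_oseenSymbol (u v w : EuclideanSpace ℝ (Fin 3)) : Measurable (oseenSymbol u v w) := by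
  unfold oseenSymbol
  fun_prop

/-- `|oseenSymbol u v w ξ| ≤ 2π‖u‖‖v‖‖w‖‖ξ‖`. [folklore] -/
theorem norm_oseenSymbol_le (u v w ξ : EuclideanSpace ℝ (Fin 3)) :
    ‖oseenSymbol u v w ξ‖ ≤ 2 * π * (‖u‖ * ‖v‖ * ‖w‖) * ‖ξ‖ := by
  unfold oseenSymbol
  rw [norm_mul, norm_mul, norm_mul, Complex.norm_I, mul_one, Complex.norm_ofNat, Complex.norm_real,
    Real.norm_of_nonneg pi_pos.le, Complex.norm_real, Real.norm_eq_abs]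
  have hu := abs_real_inner_le_norm ξ u
  have hv := abs_real_inner_le_norm ξ v
  have hw := abs_real_inner_le_norm ξ w
  have key : |⟪ξ, u⟫ * ⟪ξ, v⟫ * ⟪ξ, w⟫ / ‖ξ‖ ^ 2| ≤ ‖u‖ * ‖v‖ * ‖w‖ * ‖ξ‖ := by
    by_cases hξ : ξ = 0
    · simp [hξ]
    · have hξ0 : 0 < ‖ξ‖ := norm_pos_iff.2 hξ
      rw [abs_div, abs_of_pos (by positivity : (0 : ℝ) < ‖ξ‖ ^ 2), div_le_iff₀ (by positivity),
        abs_mul, abs_mul]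
      calc |⟪ξ, u⟫| * |⟪ξ, v⟫| * |⟪ξ, w⟫| ≤ (‖ξ‖ * ‖u‖) * (‖ξ‖ * ‖v‖) * (‖ξ‖ * ‖w‖) := by
            gcongr
        _ = ‖u‖ * ‖v‖ * ‖w‖ * ‖ξ‖ * ‖ξ‖ ^ 2 := by ring
  nlinarith [pi_pos, key, norm_nonneg ξ, norm_nonneg u, norm_nonneg v, norm_nonneg w,
    abs_nonneg (⟪ξ, u⟫ * ⟪ξ, v⟫ * ⟪ξ, w⟫ / ‖ξ‖ ^ 2)]

/-- `|oseenSymbol u v w ξ| e^{-4π²θ|ξ|²}` is integrable (`θ > 0`). [folklore] -/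
theorem integrable_oseenSymbol_mul_heatSymbol {θ : ℝ} (hθ : 0 < θ) (u v w : EuclideanSpace ℝ (Fin 3)) :
    Integrable (fun ξ => oseenSymbol u v w ξ * (heatSymbol θ ξ : ℂ)) volume := by
  have hmeas : AEStronglyMeasurable (fun ξ => oseenSymbol u v w ξ * (heatSymbol θ ξ : ℂ)) volume :=
    ((measurable_oseenSymbol u v w).mul (continuous_heatSymbol_ofReal θ).measurable).aestronglyMeasurable
  refine ((integrable_pow_mul_norm_heatSymbol hθ 1).const_mul (2 * π * (‖u‖ * ‖v‖ * ‖w‖))).mono' hmeas ?_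
  refine Eventually.of_forall fun ξ => ?_
  rw [norm_mul]
  calc ‖oseenSymbol u v w ξ‖ * ‖(heatSymbol θ ξ : ℂ)‖
      ≤ 2 * π * (‖u‖ * ‖v‖ * ‖w‖) * ‖ξ‖ * ‖(heatSymbol θ ξ : ℂ)‖ := by
        gcongr
        exact norm_oseenSymbol_le u v w ξ
    _ = 2 * π * (‖u‖ * ‖v‖ * ‖w‖) * (‖ξ‖ ^ 1 * ‖(heatSymbol θ ξ : ℂ)‖) := by ring

/-! ### The summed symbol of the slot `B` -/

/-- The summed symbol `-oseenSymbol a b c + ε · derivSymbol d` (`ε ∈ {0, 1}` a fixed real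
constant) is smooth off the origin. [folklore] -/
theorem contDiffOn_oseenSymbol_add_derivSymbol (a b c d : EuclideanSpace ℝ (Fin 3)) (ε : ℝ) :
    ContDiffOn ℝ ((⊤ : ℕ∞) : WithTop ℕ∞)
      (fun ξ => -oseenSymbol a b c ξ + (ε : ℂ) * derivSymbol d ξ) {0}ᶜ :=
  (contDiffOn_oseenSymbol a b c).neg.add (contDiffOn_const.mul (contDiffOn_derivSymbol d))

/-- The summed symbol is positively homogeneous of degree one. [folklore] -/
theorem oseenSymbol_add_derivSymbol_smul (a b c d : EuclideanSpace ℝ (Fin 3)) (ε : ℝ) (t : ℝ)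
    (ht : 0 < t) (ξ : EuclideanSpace ℝ (Fin 3)) :
    (-oseenSymbol a b c (t • ξ) + (ε : ℂ) * derivSymbol d (t • ξ)) =
      (t : ℂ) * (-oseenSymbol a b c ξ + (ε : ℂ) * derivSymbol d ξ) := by
  rw [oseenSymbol_smul a b c t ht, derivSymbol_smul d t ht]
  ring

/-- The summed symbol against the Gaussian is integrable. [folklore] -/
theorem integrable_oseenSymbol_add_derivSymbol_mul_heatSymbol {θ : ℝ} (hθ : 0 < θ)
    (a b c d : EuclideanSpace ℝ (Fin 3)) (ε : ℝ) :
    Integrable (fun ξ => (-oseenSymbol a b c ξ + (ε : ℂ) * derivSymbol d ξ) * (heatSymbol θ ξ : ℂ))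
      volume := by
  have h1 := (integrable_oseenSymbol_mul_heatSymbol hθ a b c).neg
  have h2 := (integrable_derivSymbol_mul_heatSymbol hθ d).const_mul (ε : ℂ)
  refine (h1.add h2).congr (Eventually.of_forall fun ξ => ?_)
  simp only [Pi.add_apply, Pi.neg_apply]
  ring

end Literature.Analysis.FluidPDE
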